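import Summits.NavierStokesRegularity.FluidComputer.GateBudgetColdHalfSharp
import Summits.NavierStokesRegularity.FluidComputer.GateBudgetPulseDebit
import Summits.NavierStokesRegularity.FluidComputer.GateBudgetColdTriggerFloor
import HarnessLib

/-!
# GateBudget part 92 — the cold credit: the clock identity on the cold half (§264–§265)

Cell `pub-fluidc`, blueprint seat bp1 (gen 37 close-out: SPEC-INPUT-bp1 §BQ(4)(a2)/§BR, the
second brick of the debit/credit cancellation); namespace
`Summit.NavierStokesRegularity.FluidComputer.GateBudget`, headline member
`RotorKnob.rotorCircuit K K¹⁰ ε ρ` from `delayInit` (5.6), `K ≥ 16`, `ε² ≤ 1/(6K²⁰)`,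
`K¹⁰ρ² ≤ 2ε` (`σ = ρ²e^{-K¹⁰}`, `μ = ε⁻¹K¹⁰`); modes `0 = a` (carrier), `1 = b` (clock), `2 = c`
(trigger), `3 = d` (transfer), `4 = ã` (output), `R² = b² + c²`. Imports part 87 file 2/2
(`GateBudgetColdHalfSharp`: the sharp cold window), part 90 (`GateBudgetPulseDebit`: §260's
pointwise algebra is re-done here with a running weight) and part 91
(`GateBudgetColdTriggerFloor`: the action floor and the action credit). HONEST FRAMING: a low
prior, high value-of-information experiment on Tao's machine paradigm; NOT a claim that NS blows
up. Nothing whatsoever is proved about the Navier–Stokes equations. [cite: Tao2016AveragedNS,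
§5.5 Theorem 5.3, (5.5), (5.6), (b-eq), (c-eq), (ta-eq), (energy-con), (est)]

WHY (SPEC-INPUT-bp1 §BR(2)). Part 90 DEBITS the clock on the pulse half: `θ₁² ≥ θ² -
2(1 - ã(r)²)Λ/K¹⁰ - (3 + 10⁻⁶)g/K - 10⁻⁶/K¹⁰`, `Λ = log((ρ²/K⁹)/c(T'))`. This file CREDITS it
back on the cold half `[T', r']` of part 87 §255 in the credit regime `θ₁ ≤ 1.39`: the same
identities `(b² + c²)' = 2a²(εb + σc)`, `ã' = Kd²`, the sphere, but with the RUNNING weight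
`W(t) = 1 - ã(t)²` (a frozen weight would cost `≈ 2.5g'` per rung on a cold half of length
`≈ 3`): `2εa²b = 2εW(t)b - 2εbV` with `V = b² + c² + d² ≥ 0`, `abs b ≤ 3ε/2`, and
`(2εW·B̃)' = 2εWb - 4εãKd²·B̃` where part 91's ACTION FLOOR `B̃ = B - B(T') ≥ -0.986ε` pays the
weight's derivative: `4εãKd²B̃ ≥ -3.944ε²ãKd² = -1.972ε²(ã²)'`. Hence THE COLD-CREDIT FUNCTIONAL
`R² - 2ε(1 - ã²)B̃ + 1.972ε²ã² + (3ε²/K)ã + (27/4)ε⁴t` is non-decreasing on the cold window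
(§264), and part 91's ACTION CREDIT `B̃(r') ≥ (ε/K¹⁰)(Λ - 3/K³⁰)` at the relight turns it into
THE CREDIT (§265): `θ'² ≥ θ₁² + 2(1 - ã(r')²)(Λ - 3/K³⁰)/K¹⁰ - 1.972(ã(r')² - ã(T')²) -
3(ã(r') - ã(T'))/K - 21ε² - 1/K¹⁸`. Every loss term telescopes along the ladder or is
`O(ε²)`; with part 90 the `Λ`-terms cancel up to `2Λ(ã(r')² - ã(r)²)/K¹⁰` (SPEC-INPUT-bp1
§BR(2)(a3): the rung balance and the capped-square ladder are the successor files).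

WHAT. §264 `cold_credit_pointwise` (pure algebra on the sphere), `knob_cold_credit_functional`
(the whole knob family, any clock action with the floor `B - B(s) ≥ -0.986ε` on the window),
`cold_credit_algebra` (pure bookkeeping); §265 `knob_cold_credit`: part 87 §255's hypotheses
with `θ₁ ≤ 139/100` in place of `3/2` ⟹ part 87 §255's seventeen cold-half facts VERBATIM
(window, clock zero, relight, `θ' ≤ 1.41422`, the dichotomy, pair drift, d/ã brackets) AND
`log(K/2) ≤ Λ ≤ 485K` AND THE CREDIT.

HONEST LIMITS. (i) The credit regime `θ₁ ≤ 1.39` only (part 91's cap; beyond it the seed, not the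
action, relights the trigger and part 87's branch `θ' ≥ 1.39999` is the law); (ii) one-sided (a
lower bound for `θ'`; the upper side is part 87's `θ' ≤ 1.41422`); (iii) `21ε²`, `1/K¹⁸`,
`3/K³⁰` generous; (iv) the rung balance (debit + credit) and the ladder are NOT in this file;
(v) NOTHING about Navier–Stokes.
-/

namespace Summit.NavierStokesRegularity.FluidComputer.GateBudget

open Real Set
open Literature.Analysis.FluidPDE.Tao2016AveragedNS

variable {K ε ρ : ℝ} {X : ℝ → Fin 5 → ℝ}

/-! ## §264 The cold-credit functional -/

/-- §264 POINTWISE: on the sphere, with `abs b ≤ 3ε/2`, `b² + c² ≤ 9ε²/4`, `c, σ, ã ≥ 0`,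
`K > 0` and the action floor `B̃ ≥ -0.986ε`: the derivative of
`2ε(1 - ã²)B̃ - 1.972ε²ã² - (3ε²/K)ã - (27/4)ε⁴t` (with `ã' = Kd²`, `B̃' = b`) is at most
`(b² + c²)' = 2εa²b + 2σa²c`. [derived: this file §264] -/
theorem cold_credit_pointwise {σ a b c d e Bt : ℝ} (hε : 0 ≤ ε) (hσ : 0 ≤ σ) (hK : 0 < K)
    (hc : 0 ≤ c) (hsph : a ^ 2 + b ^ 2 + c ^ 2 + d ^ 2 + e ^ 2 = 1) (hb : |b| ≤ 3 / 2 * ε)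
    (hR : b ^ 2 + c ^ 2 ≤ 9 / 4 * ε ^ 2) (he : 0 ≤ e) (hBt : -(986 / 1000 * ε) ≤ Bt) :
    2 * ε * ((0 - (K * d ^ 2 * e + e * (K * d ^ 2))) * Bt + (1 - e * e) * b)
        - (1972 / 1000 * ε ^ 2 * (K * d ^ 2 * e + e * (K * d ^ 2))
          + 3 * ε ^ 2 / K * (K * d ^ 2) + 27 / 4 * ε ^ 4 * 1)
      ≤ 2 * ε * a ^ 2 * b + 2 * σ * a ^ 2 * c := by
  have hK0 : K ≠ 0 := hK.ne'
  have hKd : 3 * ε ^ 2 / K * (K * d ^ 2) = 3 * ε ^ 2 * d ^ 2 := by field_simp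
  rw [hKd, mul_one]
  obtain ⟨V, hV⟩ : ∃ V : ℝ, V = d ^ 2 + (b ^ 2 + c ^ 2) := ⟨_, rfl⟩
  have ha2 : a ^ 2 = (1 - e * e) - V := by rw [hV]; linarith
  have hV0 : 0 ≤ V := by rw [hV]; positivity
  have hV3 : 3 * ε ^ 2 * V = 3 * ε ^ 2 * d ^ 2 + 3 * ε ^ 2 * (b ^ 2 + c ^ 2) := by
    rw [hV]; ring
  have hq : 0 ≤ K * d ^ 2 * e := by positivity
  have h1 : 0 ≤ ε * V * (3 * ε - 2 * b) :=
    mul_nonneg (mul_nonneg hε hV0) (by linarith [(abs_le.1 hb).2])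
  have h2 : 0 ≤ 2 * σ * a ^ 2 * c := by positivity
  have h3 : 0 ≤ K * d ^ 2 * e * (Bt + 986 / 1000 * ε) * ε :=
    mul_nonneg (mul_nonneg hq (by linarith)) hε
  have h4 : 3 * ε ^ 2 * (b ^ 2 + c ^ 2) ≤ 3 * ε ^ 2 * (9 / 4 * ε ^ 2) :=
    mul_le_mul_of_nonneg_left hR (by positivity)
  rw [ha2] at h2 ⊢
  linarith

/-- §264 **THE COLD-CREDIT FUNCTIONAL.** Knob family `rotorCircuit K M ε ρ` from (5.6) (any `M`;
`ε ≥ 0`, `K > 0`), any clock action `B` (`B' = b`), any window `0 ≤ s ≤ u` on which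
`b² + c² ≤ 9ε²/4`, `c ≥ 0` and the ACTION FLOOR `B(t) - B(s) ≥ -0.986ε` hold: `R²(u) ≥ R²(s) +
2ε(1 - ã(u)²)(B(u) - B(s)) - 1.972ε²(ã(u)² - ã(s)²) - (3ε²/K)(ã(u) - ã(s)) - (27/4)ε⁴(u - s)` —
`R² - 2ε(1 - ã²)(B - B(s)) + 1.972ε²ã² + (3ε²/K)ã + (27/4)ε⁴t` is non-decreasing (§264
pointwise, `bc_energy`, `ã' = Kd²`, the sphere, `ã ≥ 0`). [derived: this file §264] -/
theorem knob_cold_credit_functional {M : ℝ}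
    (hX : ∀ t, HasDerivAt X (RotorKnob.rotorCircuit K M ε ρ (X t)) t) (h0 : X 0 = delayInit)
    (hε : 0 ≤ ε) (hK : 0 < K) {B : ℝ → ℝ} (hB : ∀ t, HasDerivAt B (X t 1) t)
    {s u : ℝ} (hs : 0 ≤ s) (hsu : s ≤ u)
    (hR : ∀ t ∈ Icc s u, X t 1 ^ 2 + X t 2 ^ 2 ≤ 9 / 4 * ε ^ 2)
    (hc : ∀ t ∈ Icc s u, 0 ≤ X t 2)
    (hBt : ∀ t ∈ Icc s u, -(986 / 1000 * ε) ≤ B t - B s) :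
    X s 1 ^ 2 + X s 2 ^ 2 + 2 * ε * (1 - X u 4 ^ 2) * (B u - B s)
        - 1972 / 1000 * ε ^ 2 * (X u 4 ^ 2 - X s 4 ^ 2) - 3 * ε ^ 2 / K * (X u 4 - X s 4)
        - 27 / 4 * ε ^ 4 * (u - s) ≤ X u 1 ^ 2 + X u 2 ^ 2 := by
  have hmon : Monotone fun t => X t 4 := RotorKnob.rotorCircuit_output_monotone hK.le hX
  have he0 : 0 ≤ X s 4 := RotorKnob.e_nonneg hX h0 hK.le hs
  have he := RotorKnob.hasDerivAt_e hX
  have hXf := hX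
  rw [RotorKnob.rotorCircuit_eq_fiveGate] at hXf
  have hσ : 0 ≤ ρ ^ 2 * exp (-M) := by positivity
  have hΦ : ∀ t, HasDerivAt
      (fun r => 2 * ε * ((1 - X r 4 * X r 4) * (B r - B s))
        - (1972 / 1000 * ε ^ 2 * (X r 4 * X r 4) + 3 * ε ^ 2 / K * X r 4
          + 27 / 4 * ε ^ 4 * r))
      (2 * ε * ((0 - (K * X t 3 ^ 2 * X t 4 + X t 4 * (K * X t 3 ^ 2))) * (B t - B s)
          + (1 - X t 4 * X t 4) * X t 1)
        - (1972 / 1000 * ε ^ 2 * (K * X t 3 ^ 2 * X t 4 + X t 4 * (K * X t 3 ^ 2))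
          + 3 * ε ^ 2 / K * (K * X t 3 ^ 2) + 27 / 4 * ε ^ 4 * 1)) t := fun t =>
    ((((hasDerivAt_const t (1 : ℝ)).sub ((he t).mul (he t))).mul
        ((hB t).sub_const (B s))).const_mul (2 * ε)).sub
      (((((he t).mul (he t)).const_mul (1972 / 1000 * ε ^ 2)).add
        ((he t).const_mul (3 * ε ^ 2 / K))).add
        ((hasDerivAt_id' t).const_mul (27 / 4 * ε ^ 4)))
  have hmono := Thm53.monotoneOn_sub_of_le_deriv (f := fun r => X r 1 ^ 2 + X r 2 ^ 2)
    (f' := fun r => 2 * ε * X r 0 ^ 2 * X r 1 + 2 * (ρ ^ 2 * exp (-M)) * X r 0 ^ 2 * X r 2)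
    (φ := fun t =>
      2 * ε * ((0 - (K * X t 3 ^ 2 * X t 4 + X t 4 * (K * X t 3 ^ 2))) * (B t - B s)
          + (1 - X t 4 * X t 4) * X t 1)
        - (1972 / 1000 * ε ^ 2 * (K * X t 3 ^ 2 * X t 4 + X t 4 * (K * X t 3 ^ 2))
          + 3 * ε ^ 2 / K * (K * X t 3 ^ 2) + 27 / 4 * ε ^ 4 * 1))
    (Φ := fun r => 2 * ε * ((1 - X r 4 * X r 4) * (B r - B s))
        - (1972 / 1000 * ε ^ 2 * (X r 4 * X r 4) + 3 * ε ^ 2 / K * X r 4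
          + 27 / 4 * ε ^ 4 * r))
    (convex_Icc s u) (fun r _ => bc_energy (hXf r)) (fun r _ => hΦ r) (fun r hr => by
      have hbabs : |X r 1| ≤ 3 / 2 * ε := by
        have h1 : X r 1 ^ 2 ≤ (3 / 2 * ε) ^ 2 := by nlinarith [hR r hr, sq_nonneg (X r 2)]
        have h2 := sq_le_sq.1 h1
        rwa [abs_of_nonneg (by positivity : (0 : ℝ) ≤ 3 / 2 * ε)] at h2
      exact cold_credit_pointwise hε hσ hK (hc r hr) (RotorKnob.traj_sum_sq_eq_one hX h0 r)
        hbabs (hR r hr) (he0.trans (hmon hr.1)) (hBt r hr))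
  have h := hmono (left_mem_Icc.2 hsu) (right_mem_Icc.2 hsu) hsu
  dsimp only at h
  have hu2 : X u 4 ^ 2 = X u 4 * X u 4 := sq _
  have hs2 : X s 4 ^ 2 = X s 4 * X s 4 := sq _
  rw [hu2, hs2]
  linarith

/-- §264 PURE BOOKKEEPING: the functional's endpoint inequality (`b(T') = -θ₁ε`, `b(r') = θ'ε`,
`c(r')² ≤ ε²/K¹⁸`, `r' - T' = δ ≤ 3`, `ã(r')² ≤ 1`) plus the action credit
`(ε/K¹⁰)(Λ - δ/K³⁰) ≤ B̃(r')` gives THE CREDIT. [derived: this file §264] -/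
theorem cold_credit_algebra {θ₁ θ' cT cr eT er BΔ Λ δ : ℝ} (hε : 0 < ε) (hK : 0 < K)
    (hF : (-(θ₁ * ε)) ^ 2 + cT ^ 2 + 2 * ε * (1 - er ^ 2) * BΔ
        - 1972 / 1000 * ε ^ 2 * (er ^ 2 - eT ^ 2) - 3 * ε ^ 2 / K * (er - eT)
        - 27 / 4 * ε ^ 4 * δ ≤ (θ' * ε) ^ 2 + cr ^ 2)
    (hcr : cr ^ 2 ≤ ε ^ 2 / K ^ 18) (hδ : δ ≤ 3) (her : er ^ 2 ≤ 1)
    (hcred : ε / K ^ 10 * (Λ - δ / K ^ 30) ≤ BΔ) :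
    θ₁ ^ 2 + 2 * (1 - er ^ 2) * (Λ - 3 / K ^ 30) / K ^ 10
        - 1972 / 1000 * (er ^ 2 - eT ^ 2) - 3 * (er - eT) / K - 21 * ε ^ 2 - 1 / K ^ 18
      ≤ θ' ^ 2 := by
  have hK30 : (0 : ℝ) < K ^ 30 := by positivity
  have hW0 : 0 ≤ 2 * ε * (1 - er ^ 2) := by nlinarith [hε.le]
  have f1 : 2 * ε * (1 - er ^ 2) * (ε / K ^ 10 * (Λ - δ / K ^ 30))
      ≤ 2 * ε * (1 - er ^ 2) * BΔ := mul_le_mul_of_nonneg_left hcred hW0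
  have f2 : ε / K ^ 10 * (Λ - 3 / K ^ 30) ≤ ε / K ^ 10 * (Λ - δ / K ^ 30) :=
    mul_le_mul_of_nonneg_left (by linarith [div_le_div_of_nonneg_right hδ hK30.le])
      (by positivity)
  have f3 := mul_le_mul_of_nonneg_left f2 hW0
  have f4 : 27 / 4 * ε ^ 4 * δ ≤ 27 / 4 * ε ^ 4 * 3 := by
    nlinarith [pow_pos hε 4]
  have key : ε ^ 2 * (θ₁ ^ 2 + 2 * (1 - er ^ 2) * (Λ - 3 / K ^ 30) / K ^ 10
      - 1972 / 1000 * (er ^ 2 - eT ^ 2) - 3 * (er - eT) / K - 21 * ε ^ 2 - 1 / K ^ 18)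
        ≤ ε ^ 2 * θ' ^ 2 := by
    have e1 : ε ^ 2 * (2 * (1 - er ^ 2) * (Λ - 3 / K ^ 30) / K ^ 10)
        = 2 * ε * (1 - er ^ 2) * (ε / K ^ 10 * (Λ - 3 / K ^ 30)) := by ring
    have e2 : ε ^ 2 * (1 / K ^ 18) = ε ^ 2 / K ^ 18 := by ring
    have e3 : ε ^ 2 * (3 * (er - eT) / K) = 3 * ε ^ 2 / K * (er - eT) := by ring
    nlinarith [f1, f3, f4, hF, hcr, sq_nonneg cT, e1, e2, e3, sq_nonneg ε]
  exact le_of_mul_le_mul_left key (pow_pos hε 2)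

/-! ## §265 The cold credit on the sharp cold half -/

/-- §265 **THE COLD CREDIT** (headline member from `delayInit`; part 87 §255's hypotheses with
the credit-regime cap `θ₁ ≤ 139/100`). THEN part 87 §255's cold half VERBATIM — `T' + 1 ≤ tz`,
`b(tz) = 0`, `tz < r' < T' + 3`, `c ≤ ρ²/K⁹` on `[T', r']`, `c(r') = ρ²/K⁹`, `b(r') = θ'ε`,
`θ' ≤ 1.41422`, the dichotomy, the pair drift, `9/4 ≤ r' - T'`, the `d`/`ã` brackets — AND, with
`Λ = log(ρ²/K⁹) - log c(T')`: `log(K/2) ≤ Λ ≤ 485K` and THE CREDIT `θ'² ≥ θ₁² +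
2(1 - ã(r')²)(Λ - 3/K³⁰)/K¹⁰ - 1.972(ã(r')² - ã(T')²) - 3(ã(r') - ã(T'))/K - 21ε² - 1/K¹⁸`
(§264's functional on `[T', r']`: `abs b ≤ 1.41422ε` by part 58 §174's monotone cold clock,
`c > 0` and the action floor by part 91 §262, the action credit by part 91 §263).
[derived: part 87 §255, part 58 §174, part 91 §262–§263, this file §264] -/
theorem knob_cold_credit
    (hX : ∀ t, HasDerivAt X (RotorKnob.rotorCircuit K (K ^ 10) ε ρ (X t)) t)
    (h0 : X 0 = delayInit) (hK : 16 ≤ K) (hε : 0 < ε) (hεK : ε ^ 2 ≤ 1 / (6 * K ^ 20))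
    (hρ : 0 < ρ) (hhi : K ^ 10 * ρ ^ 2 ≤ 2 * ε) {T' θ₁ : ℝ} (hT'0 : 0 ≤ T')
    (hθ1 : 1249 / 1000 ≤ θ₁) (hθ139 : θ₁ ≤ 139 / 100) (hbT : X T' 1 = -(θ₁ * ε))
    (hP : X T' 3 ^ 2 + X T' 4 ^ 2 ≤ 1 / 50) (hℓ : ρ ^ 2 / K ^ 9 * exp (-(485 * K)) ≤ X T' 2)
    (hcT : X T' 2 ≤ 2 * ρ ^ 2 / K ^ 10) (he0 : 0 ≤ X T' 4) :
    ∃ tz r' θ' : ℝ,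
      (T' + 1 ≤ tz ∧ X tz 1 = 0 ∧ tz < r' ∧ r' < T' + 3 ∧
        (∀ t ∈ Icc T' r', X t 2 ≤ ρ ^ 2 / K ^ 9) ∧ X r' 2 = ρ ^ 2 / K ^ 9) ∧
      (X r' 1 = θ' * ε ∧ θ' ≤ 141422 / 100000 ∧
        (θ₁ - 37 * (|X T' 3| + 4 / K ^ 9) / K ^ 9 ≤ θ' ∨ 139999 / 100000 ≤ θ') ∧
        |X r' 3 ^ 2 + X r' 4 ^ 2 - (X T' 3 ^ 2 + X T' 4 ^ 2)|
          ≤ 6 * (|X T' 3| + 3 / K ^ 9) / K ^ 9) ∧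
      (9 / 4 ≤ r' - T' ∧ |X r' 3| ≤ |X T' 3| * exp (-(9 / 4 * (K * X T' 4))) + 3 / K ^ 9 ∧
        X T' 4 ≤ X r' 4 ∧ X r' 4 ≤ X T' 4 + 3 * K * (|X T' 3| + 3 / K ^ 9) ^ 2 ∧
        ∀ t ∈ Icc T' r', |X t 3| ≤ |X T' 3| + 3 / K ^ 9) ∧
      (log (K / 2) ≤ log (ρ ^ 2 / K ^ 9) - log (X T' 2) ∧
        log (ρ ^ 2 / K ^ 9) - log (X T' 2) ≤ 485 * K ∧
        θ₁ ^ 2 + 2 * (1 - X r' 4 ^ 2) * (log (ρ ^ 2 / K ^ 9) - log (X T' 2) - 3 / K ^ 30) / K ^ 10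
            - 1972 / 1000 * (X r' 4 ^ 2 - X T' 4 ^ 2) - 3 * (X r' 4 - X T' 4) / K
            - 21 * ε ^ 2 - 1 / K ^ 18 ≤ θ' ^ 2) := by
  have hK0 : (0 : ℝ) < K := by linarith
  have hKne : K ≠ 0 := hK0.ne'
  have h9 : (0 : ℝ) < ρ ^ 2 / K ^ 9 := by positivity
  have hθ0 : (0 : ℝ) ≤ θ₁ := by linarith
  obtain ⟨tz, r', θ', h1, h2, h3⟩ :=
    knob_cold_half_sharp hX h0 hK hε hεK hρ hhi hT'0 hθ1 (by linarith) hbT hP hℓ hcT he0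
  refine ⟨tz, r', θ', h1, h2, h3, ?_⟩
  obtain ⟨htz, -, htr, hr3, hcw, hcr'⟩ := h1
  obtain ⟨hbr', hθ'2, -, -⟩ := h2
  have hT'r : T' ≤ r' := by linarith
  -- (1) a clock action, part 91's floor / credit, the monotone cold clock
  have hXf := hX
  rw [RotorKnob.rotorCircuit_eq_fiveGate] at hXf
  obtain ⟨B, hB⟩ := exists_clock_action hXf
  have h91 := knob_cold_action_credit hX h0 hK hε hεK hρ hhi hT'0 hr3.le hθ0 hθ139 hbT hP hcw hℓ hB
  have hfl := fun t (ht : t ∈ Icc T' r') =>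
    knob_cold_trigger_floor hX h0 hK hε hεK hρ hhi hT'0 hr3.le hθ0 hθ139 hbT hP hcw hℓ hB ht
  have hmono := knob_cold_clock_mono hX h0 hK hε hεK hρ hhi hT'0 hr3.le hθ0 (by linarith) hbT
    rfl hcw (by linarith)
  -- (2) `R² ≤ 9ε²/4` on the cold window: `-θ₁ε ≤ b ≤ θ'ε`, `0 ≤ c ≤ ρ²/K⁹`
  obtain ⟨-, hρε, -⟩ := pulse_clock_fine_numerics hK hε hρ hhi
  have hc2 : (ρ ^ 2 / K ^ 9) ^ 2 ≤ ε ^ 2 / K ^ 18 := by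
    rw [div_pow, show (K ^ 9) ^ 2 = K ^ 18 by ring]
    exact div_le_div_of_nonneg_right (pow_le_pow_left₀ (sq_nonneg ρ) hρε 2) (by positivity)
  have h18 : ε ^ 2 / K ^ 18 ≤ ε ^ 2 / 10 ^ 6 := by
    have h := pow_le_pow_left₀ (by norm_num : (0 : ℝ) ≤ 16) hK 18
    exact div_le_div_of_nonneg_left (sq_nonneg ε) (by positivity) (by norm_num at h ⊢; linarith)
  have hR : ∀ t ∈ Icc T' r', X t 1 ^ 2 + X t 2 ^ 2 ≤ 9 / 4 * ε ^ 2 := fun t ht => by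
    have hlo : X T' 1 ≤ X t 1 := hmono.monotoneOn (left_mem_Icc.2 hT'r) ht ht.1
    have hup : X t 1 ≤ X r' 1 := hmono.monotoneOn ht (right_mem_Icc.2 hT'r) ht.2
    rw [hbT] at hlo
    rw [hbr'] at hup
    have hθε : θ₁ * ε ≤ 141422 / 100000 * ε := mul_le_mul_of_nonneg_right (by linarith) hε.le
    have hθε' : θ' * ε ≤ 141422 / 100000 * ε := mul_le_mul_of_nonneg_right hθ'2 hε.le
    have hb : |X t 1| ≤ 141422 / 100000 * ε := abs_le.2 ⟨by linarith, by linarith⟩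
    have hb2 : X t 1 ^ 2 ≤ (141422 / 100000 * ε) ^ 2 := by
      have h := pow_le_pow_left₀ (abs_nonneg _) hb 2
      rwa [sq_abs] at h
    have hct2 : X t 2 ^ 2 ≤ (ρ ^ 2 / K ^ 9) ^ 2 := pow_le_pow_left₀ (hfl t ht).1.le (hcw t ht) 2
    nlinarith [hb2, hct2, hc2, h18, sq_nonneg ε]
  have hc0 : ∀ t ∈ Icc T' r', 0 ≤ X t 2 := fun t ht => (hfl t ht).1.le
  have hBt : ∀ t ∈ Icc T' r', -(986 / 1000 * ε) ≤ B t - B T' := fun t ht => (h91.1 t ht).1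
  -- (3) the functional on `[T', r']` and the `Λ` bracket
  have hF := knob_cold_credit_functional hX h0 hε.le hK0 hB hT'0 hT'r hR hc0 hBt
  rw [hbT, hbr'] at hF
  have hcT0 : 0 < X T' 2 := (hfl T' (left_mem_Icc.2 hT'r)).1
  have hΛlo : log (K / 2) ≤ log (ρ ^ 2 / K ^ 9) - log (X T' 2) := by
    have e1 : log (K / 2) = log (ρ ^ 2 / K ^ 9) - log (2 * ρ ^ 2 / K ^ 10) := by
      rw [← Real.log_div h9.ne' (by positivity)]
      congr 1
      field_simp
    rw [e1]
    linarith [Real.log_le_log hcT0 hcT]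
  have hΛhi : log (ρ ^ 2 / K ^ 9) - log (X T' 2) ≤ 485 * K := by
    have h := Real.log_le_log (by positivity) hℓ
    rw [Real.log_mul h9.ne' (Real.exp_pos _).ne', Real.log_exp] at h
    linarith
  refine ⟨hΛlo, hΛhi, ?_⟩
  -- (4) the credit
  have hcr2 : X r' 2 ^ 2 ≤ ε ^ 2 / K ^ 18 := by rw [hcr']; exact hc2
  have her : X r' 4 ^ 2 ≤ 1 := by
    have h := pow_le_pow_left₀ (abs_nonneg _) (RotorKnob.traj_abs_le_one hX h0 r' 4) 2
    rwa [sq_abs, one_pow] at h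
  exact cold_credit_algebra hε hK0 hF hcr2 (by linarith) her
    (h91.2 r' (right_mem_Icc.2 hT'r) hcr')

end Summit.NavierStokesRegularity.FluidComputer.GateBudget
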